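import Summits.QuantumFields.GaugeBoot.Rows.KZL2rpD4PairAsm
import Summits.QuantumFields.GaugeBoot.Rows.KZL2rpD4RowHChk1
import Summits.QuantumFields.GaugeBoot.Rows.KZL2rpD4RowHChk2
import Summits.QuantumFields.GaugeBoot.Rows.KZL2rpD4RowHChk3
import Summits.QuantumFields.GaugeBoot.Rows.KZL2rpD4RowHChk4
import Summits.QuantumFields.GaugeBoot.Rows.KZL2rpD4RowHChk5
import Summits.QuantumFields.GaugeBoot.Rows.KZL2rpD4RowRChk1
import Summits.QuantumFields.GaugeBoot.Rows.KZL2rpD4RowRChk2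
import Summits.QuantumFields.GaugeBoot.Rows.KZL2rpD4RowRChk3
import Summits.QuantumFields.GaugeBoot.Rows.KZL2rpD4RowRChk4
import Summits.QuantumFields.GaugeBoot.Rows.KZL2rpD4RowRChk5
import Summits.QuantumFields.GaugeBoot.Rows.KZL2rpD4RowRChk6
import Summits.QuantumFields.GaugeBoot.Rows.KZL2rpD4RowRChk7
import Summits.QuantumFields.GaugeBoot.Rows.SymAsm
import HarnessLib

/-!
# Gauge-boot: every (representative row, line) raw entry is a problem variable in expectation

Cell `pub-gaugeboot` (HOME `run/shared/lean/pub/pub-gaugeboot/`), seat lean1 (SYMMETRY-FACTORISED torus layer for the kz-L2-rp-4D family =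
rows C91–C106 / C123–C127; label set, lines, irrep data, pair/row class certification, orbit tables, reduction identity, assembly).

HONEST FRAMING (page 1 of every file of this cell): certified bounds on lattice expectations at STATED coupling,
gauge group, dimension and torus size; NOT a mass gap, NOT a continuum limit, NOT a string tension, NOT large `N`.
The venture is explicitly NOT Yang–Mills-summit-bearing (barriers `FixedCouplingUltralocality`,
`PerturbativeInvisibility`).

Assembles the transport checks with the pair classes: `⟨W_0((S row_r)⁻¹(S b))⟩ = y (rowClsH r b)` (`rowH_W`) and the site / link
analogues on the half-space rows (`rowS_W`, `rowL_W`), via `SymB4.W_raw{H,S,L}w_transport` (invariance of the torus functionals under the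
symmetry codes, `SymGram`) and `pair{H,S,L}_W`.
-/

noncomputable section

open Literature.MathematicalPhysics.QuantumFieldTheory

namespace Summit.QuantumFields.GaugeBoot

namespace KZL2rpD4

/-- Every entry of the H transport table is correct (assembly). -/
theorem rowH_ok (r : Fin 50) (b : Fin 1777) : RowHOK r.val b.val := by
  have h0 : 0 ≤ r.val := Nat.zero_le _
  rcases Nat.lt_or_ge r.val 6 with h1 | h1
  · exact SymB4.nested_elim (P := fun b => RowHOK r.val b) (lo := 0) (hi := 1777) (A := 28) (B := 64) (by norm_num) (rowH_ok_0_6 r h0 h1) b.val (Nat.zero_le _) b.isLt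
  rcases Nat.lt_or_ge r.val 12 with h2 | h2
  · exact SymB4.nested_elim (P := fun b => RowHOK r.val b) (lo := 0) (hi := 1777) (A := 28) (B := 64) (by norm_num) (rowH_ok_6_12 r h1 h2) b.val (Nat.zero_le _) b.isLt
  rcases Nat.lt_or_ge r.val 18 with h3 | h3
  · exact SymB4.nested_elim (P := fun b => RowHOK r.val b) (lo := 0) (hi := 1777) (A := 28) (B := 64) (by norm_num) (rowH_ok_12_18 r h2 h3) b.val (Nat.zero_le _) b.isLt
  rcases Nat.lt_or_ge r.val 24 with h4 | h4
  · exact SymB4.nested_elim (P := fun b => RowHOK r.val b) (lo := 0) (hi := 1777) (A := 28) (B := 64) (by norm_num) (rowH_ok_18_24 r h3 h4) b.val (Nat.zero_le _) b.isLt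
  rcases Nat.lt_or_ge r.val 30 with h5 | h5
  · exact SymB4.nested_elim (P := fun b => RowHOK r.val b) (lo := 0) (hi := 1777) (A := 28) (B := 64) (by norm_num) (rowH_ok_24_30 r h4 h5) b.val (Nat.zero_le _) b.isLt
  rcases Nat.lt_or_ge r.val 36 with h6 | h6
  · exact SymB4.nested_elim (P := fun b => RowHOK r.val b) (lo := 0) (hi := 1777) (A := 28) (B := 64) (by norm_num) (rowH_ok_30_36 r h5 h6) b.val (Nat.zero_le _) b.isLt
  rcases Nat.lt_or_ge r.val 42 with h7 | h7
  · exact SymB4.nested_elim (P := fun b => RowHOK r.val b) (lo := 0) (hi := 1777) (A := 28) (B := 64) (by norm_num) (rowH_ok_36_42 r h6 h7) b.val (Nat.zero_le _) b.isLt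
  rcases Nat.lt_or_ge r.val 48 with h8 | h8
  · exact SymB4.nested_elim (P := fun b => RowHOK r.val b) (lo := 0) (hi := 1777) (A := 28) (B := 64) (by norm_num) (rowH_ok_42_48 r h7 h8) b.val (Nat.zero_le _) b.isLt
  exact SymB4.nested_elim (P := fun b => RowHOK r.val b) (lo := 0) (hi := 1777) (A := 28) (B := 64) (by norm_num) (rowH_ok_48_50 r h8 r.isLt) b.val (Nat.zero_le _) b.isLt

/-- Every entry of the R transport table is correct (assembly). -/
theorem rowR_ok (r : Fin 76) (b : Fin 1147) : RowROK r.val b.val := by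
  have h0 : 0 ≤ r.val := Nat.zero_le _
  rcases Nat.lt_or_ge r.val 6 with h1 | h1
  · exact SymB4.nested_elim (P := fun b => RowROK r.val b) (lo := 0) (hi := 1147) (A := 18) (B := 64) (by norm_num) (rowR_ok_0_6 r h0 h1) b.val (Nat.zero_le _) b.isLt
  rcases Nat.lt_or_ge r.val 12 with h2 | h2
  · exact SymB4.nested_elim (P := fun b => RowROK r.val b) (lo := 0) (hi := 1147) (A := 18) (B := 64) (by norm_num) (rowR_ok_6_12 r h1 h2) b.val (Nat.zero_le _) b.isLt
  rcases Nat.lt_or_ge r.val 18 with h3 | h3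
  · exact SymB4.nested_elim (P := fun b => RowROK r.val b) (lo := 0) (hi := 1147) (A := 18) (B := 64) (by norm_num) (rowR_ok_12_18 r h2 h3) b.val (Nat.zero_le _) b.isLt
  rcases Nat.lt_or_ge r.val 24 with h4 | h4
  · exact SymB4.nested_elim (P := fun b => RowROK r.val b) (lo := 0) (hi := 1147) (A := 18) (B := 64) (by norm_num) (rowR_ok_18_24 r h3 h4) b.val (Nat.zero_le _) b.isLt
  rcases Nat.lt_or_ge r.val 30 with h5 | h5
  · exact SymB4.nested_elim (P := fun b => RowROK r.val b) (lo := 0) (hi := 1147) (A := 18) (B := 64) (by norm_num) (rowR_ok_24_30 r h4 h5) b.val (Nat.zero_le _) b.isLt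
  rcases Nat.lt_or_ge r.val 36 with h6 | h6
  · exact SymB4.nested_elim (P := fun b => RowROK r.val b) (lo := 0) (hi := 1147) (A := 18) (B := 64) (by norm_num) (rowR_ok_30_36 r h5 h6) b.val (Nat.zero_le _) b.isLt
  rcases Nat.lt_or_ge r.val 42 with h7 | h7
  · exact SymB4.nested_elim (P := fun b => RowROK r.val b) (lo := 0) (hi := 1147) (A := 18) (B := 64) (by norm_num) (rowR_ok_36_42 r h6 h7) b.val (Nat.zero_le _) b.isLt
  rcases Nat.lt_or_ge r.val 48 with h8 | h8
  · exact SymB4.nested_elim (P := fun b => RowROK r.val b) (lo := 0) (hi := 1147) (A := 18) (B := 64) (by norm_num) (rowR_ok_42_48 r h7 h8) b.val (Nat.zero_le _) b.isLt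
  rcases Nat.lt_or_ge r.val 54 with h9 | h9
  · exact SymB4.nested_elim (P := fun b => RowROK r.val b) (lo := 0) (hi := 1147) (A := 18) (B := 64) (by norm_num) (rowR_ok_48_54 r h8 h9) b.val (Nat.zero_le _) b.isLt
  rcases Nat.lt_or_ge r.val 60 with h10 | h10
  · exact SymB4.nested_elim (P := fun b => RowROK r.val b) (lo := 0) (hi := 1147) (A := 18) (B := 64) (by norm_num) (rowR_ok_54_60 r h9 h10) b.val (Nat.zero_le _) b.isLt
  rcases Nat.lt_or_ge r.val 66 with h11 | h11
  · exact SymB4.nested_elim (P := fun b => RowROK r.val b) (lo := 0) (hi := 1147) (A := 18) (B := 64) (by norm_num) (rowR_ok_60_66 r h10 h11) b.val (Nat.zero_le _) b.isLt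
  rcases Nat.lt_or_ge r.val 72 with h12 | h12
  · exact SymB4.nested_elim (P := fun b => RowROK r.val b) (lo := 0) (hi := 1147) (A := 18) (B := 64) (by norm_num) (rowR_ok_66_72 r h11 h12) b.val (Nat.zero_le _) b.isLt
  exact SymB4.nested_elim (P := fun b => RowROK r.val b) (lo := 0) (hi := 1147) (A := 18) (B := 64) (by norm_num) (rowR_ok_72_76 r h12 r.isLt) b.val (Nat.zero_le _) b.isLt

variable (β : ℝ) (L : ℕ) [NeZero L]

/-- Closedness of representative / general lines in the `Sn` / `Rn` spelling. -/
theorem disp_Sn (b : Fin 1777) : Word.disp (Sn b.val) = 0 := disp_S b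

/-- Same for `Rn`. -/
theorem disp_Rn (b : Fin 1147) : Word.disp (Rn b.val) = 0 := disp_R b

/-- **Hermitian row entries are problem variables**: `⟨W_0((S row_r)⁻¹(S b))⟩ = y (rowClsH r b)`. -/
theorem rowH_W (r : Fin 50) (b : Fin 1777) : Rung0D4.W β L (SymB4.rawHw (Sn (rowLineH r.val)) (Sn b.val)) = y β L (rowClsH r.val b.val) := by
  obtain ⟨hu, h⟩ := rowH_ok r b
  rw [SymB4.W_rawHw_transport β L ⟨_, hu⟩ (disp_S _) (disp_S _) _ h]
  exact pairH_W β L _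

/-- **Site row entries are problem variables.** -/
theorem rowS_W (r : Fin 76) (b : Fin 1147) : Rung0D4.W β L (SymB4.rawSw (Rn (rowLineR r.val)) (Rn b.val)) = y β L (rowClsS r.val b.val) := by
  obtain ⟨hu, hf, h⟩ := rowR_ok r b
  rw [SymB4.W_rawSw_transport β L ⟨_, hu⟩ hf (disp_R _) (disp_R _) _ h]
  exact pairS_W β L _

/-- **Link row entries are problem variables.** -/
theorem rowL_W (r : Fin 76) (b : Fin 1147) : Rung0D4.W β L (SymB4.rawLw (Rn (rowLineR r.val)) (Rn b.val)) = y β L (rowClsL r.val b.val) := by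
  obtain ⟨hu, hf, h⟩ := rowR_ok r b
  rw [SymB4.W_rawLw_transport β L ⟨_, hu⟩ hf (disp_R _) (disp_R _) _ h]
  exact pairL_W β L _

end KZL2rpD4

end Summit.QuantumFields.GaugeBoot

end
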